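import Mathlib
import Summits.ResolutionOfSingularities.ResolutionOfSingularities.Theorems.FrobeniusLadderFRationalResolutionCompletedBaseChangeFibre

/-!
# Crux `FrobeniusLadder.FRationalResolution` (stmt-ResolutionOfSingularities-15317), line `redirect`,
# stub `stub_diagonalizableQuotientResolution` — the ring engine of the transport step (T) WITHOUT faithful flatness,
# and its MODEL form: base change from a finite-type model `T` to the completion `(T_𝔳)^` at a maximal ideal

`…CompletedBaseChangeFibre` (p842214/p842241) compares `C` and `C ⊗_A B` over `V(𝔪)` when `B` is FAITHFULLY flat over `A`
with `B = A + 𝔪B`. In the application of MEMO-15317-leafhand2-g18 §2c (T) the base is the MODEL ring `T` (a toric chart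
ring `κ[P]`, of finite type over a field — so that the chart rings of `Bl_J(Spec T)` stay of finite type over a field, as
`…PointBlowupOfCompletion.isRegular_affineBlowup_maximalIdeal_of_ringEquiv_adicCompletion` requires) and `B = Ê ≅ (T_𝔳)^`,
which is flat but NOT faithfully flat over `T`. Faithful flatness was used only for `𝔫 (C ⊗_A B) ∩ C = 𝔫`; here this is
proved instead from `A/𝔪 ≅ B/𝔪B` (i.e. `B = A + 𝔪B` and `𝔪B ∩ A = 𝔪`) by mapping `C ⊗_A B → C/𝔫` through
`B → B/𝔪B ≅ A/𝔪 → C/𝔫`. Everything else is as in `…CompletedBaseChangeFibre`, with `Module.Flat` in place of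
`Module.FaithfullyFlat`:
* `quotientMap_bijective` — `A/𝔪 → B/𝔪B` is bijective; `exists_algHom_quotient` — an `A`-algebra map `B → C/𝔫` for `𝔫 ⊇ 𝔪C`;
* ★ `comap_map_eq` — **`𝔫 (C ⊗_A B) ∩ C = 𝔫`** (no flatness at all);
* `isPrime_map`, `existsUnique_isPrime_comap_eq` — `𝔫 (C ⊗_A B)` is the unique prime over `𝔫`;
* ★★ `exists_ringEquiv_adicCompletion` — `B` flat: **`(C_𝔫)^ ≃+* ((C ⊗_A B)_𝔑)^`** over `Localization.localRingHom`;
* ★★ `isRegularLocalRing_iff`, `comap_bijOn_not_isRegularLocalRing`, `finite_not_isRegularLocalRing_of_finite` — Noetherian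
  case: regularity agrees, the non-regular primes over `V(𝔪)` correspond bijectively, finiteness transfers;
* THE MODEL FORM (§4): for `T` Noetherian with a maximal ideal `𝔳` and `Ê = (T_𝔳)^` as a `T`-algebra:
  `map_eq_maximalIdeal_adicCompletion` (`𝔳Ê = 𝔪_Ê`), `flat_adicCompletion_atPrime` (`Ê` is `T`-flat),
  `forall_exists_sub_mem_adicCompletion_atPrime` (`Ê = T + 𝔳Ê`), `comap_map_le_adicCompletion_atPrime` (`𝔳Ê ∩ T = 𝔳`), and
  ★★ **`existsUnique_isPrime_comap_eq_model` / `isRegularLocalRing_iff_model` / `finite_not_isRegularLocalRing_model`** —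
  for every `T`-algebra `C` (e.g. a chart ring `T[J/a]` of `Bl_J(Spec T)`, so that `C ⊗_T Ê = Ê[JÊ/a]` is the chart ring of
  `Bl_{JÊ}(Spec Ê)`): the primes of `C ⊗_T Ê` over `V(𝔳)` correspond ONE-TO-ONE to the primes of `C` over `V(𝔳)`, with the
  same regularity, and «finitely many non-regular primes over `V(𝔳)`» transfers from `C` to `C ⊗_T Ê`.
So the fan facts (β) computed on the model `Bl_J(Spec κ[P])` over the vertex give the point-level inputs of
`…MaximalIdealTower.hloc_of_maximalIdealPow_then_singularPoints` / `…IntrinsicRecipeFinite` chart by chart; the remaining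
scheme-side step of (T) is the identification of the stalks of `Bl_{JÊ}(Spec Ê)` with localizations of the chart rings
`C ⊗_T Ê` (tree `IsBlowup.pullback_snd_of_flat`, `pullbackSpecIso`), not done here.

Honest label: ring-level plumbing toward ONE leaf stub (no stub, crux or summit closed). No definitions, no named facts,
no sorry. [cite: Matsumura1987, Thm. 8.4; Thm. 8.14; Thm. 22.4 (i); §19 p. 158] [cite: StacksProject, Tag 0C4G; Tag 02G8;
Tag 05GG] [folklore]
-/

noncomputable section

-- single-problem summit: the doubled namespace component is forced
set_option linter.dupNamespace false

open IsLocalRing AlgebraicGeometry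
open scoped TensorProduct
open Literature.AlgebraicGeometry.Resolution

namespace Summit.ResolutionOfSingularities.ResolutionOfSingularities.Theorems.FRationalResolution.CompletedBaseChangeFibreFlat

variable {A B C : Type} [CommRing A] [CommRing B] [CommRing C] [Algebra A B] [Algebra A C]

/-! ## §1 `A/𝔪 ≅ B/𝔪B` and the map `B → C/𝔫` -/

/-- `A/𝔪 → B/𝔪B` is bijective when `B = A + 𝔪B` and `𝔪B ∩ A ⊆ 𝔪`. [folklore] -/
theorem quotientMap_bijective (𝔪 : Ideal A)
    (hres : ∀ b : B, ∃ a : A, b - algebraMap A B a ∈ 𝔪.map (algebraMap A B))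
    (hinj : (𝔪.map (algebraMap A B)).comap (algebraMap A B) ≤ 𝔪) :
    Function.Bijective (Ideal.quotientMap (𝔪.map (algebraMap A B)) (algebraMap A B) Ideal.le_comap_map) := by
  refine ⟨Ideal.quotientMap_injective' hinj, fun y => ?_⟩
  obtain ⟨b, rfl⟩ := Ideal.Quotient.mk_surjective y
  obtain ⟨a, ha⟩ := hres b
  refine ⟨Ideal.Quotient.mk 𝔪 a, ?_⟩
  rw [Ideal.quotientMap_mk, eq_comm, Ideal.Quotient.eq]
  exact ha

/-- An `A`-algebra homomorphism `B → C/𝔫` for `𝔫 ⊇ 𝔪C`: `B → B/𝔪B ≅ A/𝔪 → C/𝔫`. [folklore] -/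
theorem exists_algHom_quotient (𝔪 : Ideal A)
    (hres : ∀ b : B, ∃ a : A, b - algebraMap A B a ∈ 𝔪.map (algebraMap A B))
    (hinj : (𝔪.map (algebraMap A B)).comap (algebraMap A B) ≤ 𝔪)
    (𝔫 : Ideal C) (h𝔫 : 𝔪.map (algebraMap A C) ≤ 𝔫) :
    ∃ g : B →ₐ[A] C ⧸ 𝔫, ∀ a : A, g (algebraMap A B a) = Ideal.Quotient.mk 𝔫 (algebraMap A C a) := by
  have h𝔫' : 𝔪 ≤ 𝔫.comap (algebraMap A C) := Ideal.map_le_iff_le_comap.mp h𝔫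
  let e : A ⧸ 𝔪 ≃+* B ⧸ 𝔪.map (algebraMap A B) :=
    RingEquiv.ofBijective _ (quotientMap_bijective 𝔪 hres hinj)
  let g₀ : B →+* C ⧸ 𝔫 :=
    (Ideal.quotientMap 𝔫 (algebraMap A C) h𝔫').comp
      (e.symm.toRingHom.comp (Ideal.Quotient.mk (𝔪.map (algebraMap A B))))
  have hg₀ : ∀ a : A, g₀ (algebraMap A B a) = Ideal.Quotient.mk 𝔫 (algebraMap A C a) := by
    intro a
    have he : e (Ideal.Quotient.mk 𝔪 a) = Ideal.Quotient.mk (𝔪.map (algebraMap A B)) (algebraMap A B a) := by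
      rw [RingEquiv.ofBijective_apply, Ideal.quotientMap_mk]
    have he' : e.symm (Ideal.Quotient.mk (𝔪.map (algebraMap A B)) (algebraMap A B a)) = Ideal.Quotient.mk 𝔪 a := by
      rw [← he, RingEquiv.symm_apply_apply]
    change Ideal.quotientMap 𝔫 (algebraMap A C) h𝔫'
      (e.symm (Ideal.Quotient.mk (𝔪.map (algebraMap A B)) (algebraMap A B a))) = _
    rw [he', Ideal.quotientMap_mk]
  refine ⟨{ toRingHom := g₀, commutes' := fun a => ?_ }, fun a => hg₀ a⟩
  rw [RingHom.toFun_eq_coe, hg₀, ← Ideal.Quotient.algebraMap_eq, ← IsScalarTower.algebraMap_apply]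

/-! ## §2 `𝔫 (C ⊗_A B)` is the unique prime over `𝔫`, without flatness -/

/-- ★ **`𝔫 (C ⊗_A B) ∩ C = 𝔫`** for `𝔫 ⊇ 𝔪C`, when `B = A + 𝔪B` and `𝔪B ∩ A ⊆ 𝔪` (no flatness): the `A`-algebra map
`h : C ⊗_A B → C/𝔫`, `c ⊗ b ↦ c̄·g(b)` kills `𝔫 (C ⊗_A B)` and sends `c ⊗ 1` to `c̄`. [folklore] -/
theorem comap_map_eq (𝔪 : Ideal A)
    (hres : ∀ b : B, ∃ a : A, b - algebraMap A B a ∈ 𝔪.map (algebraMap A B))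
    (hinj : (𝔪.map (algebraMap A B)).comap (algebraMap A B) ≤ 𝔪)
    (𝔫 : Ideal C) (h𝔫 : 𝔪.map (algebraMap A C) ≤ 𝔫) :
    (𝔫.map (algebraMap C (C ⊗[A] B))).comap (algebraMap C (C ⊗[A] B)) = 𝔫 := by
  obtain ⟨g, -⟩ := exists_algHom_quotient 𝔪 hres hinj 𝔫 h𝔫
  let h : C ⊗[A] B →ₐ[A] C ⧸ 𝔫 :=
    Algebra.TensorProduct.lift (Ideal.Quotient.mkₐ A 𝔫) g (fun _ _ => Commute.all _ _)
  have hh : ∀ c : C, h (algebraMap C (C ⊗[A] B) c) = Ideal.Quotient.mk 𝔫 c := by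
    intro c
    rw [Algebra.TensorProduct.algebraMap_apply, Algebra.algebraMap_self_apply]
    change Algebra.TensorProduct.lift (Ideal.Quotient.mkₐ A 𝔫) g _ (c ⊗ₜ[A] (1 : B)) = _
    rw [Algebra.TensorProduct.lift_tmul, map_one, mul_one, Ideal.Quotient.mkₐ_eq_mk]
  have hker : 𝔫.map (algebraMap C (C ⊗[A] B)) ≤ RingHom.ker h.toRingHom := by
    rw [Ideal.map_le_iff_le_comap]
    intro n hn
    rw [Ideal.mem_comap, RingHom.mem_ker, AlgHom.toRingHom_eq_coe, AlgHom.coe_toRingHom, hh,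
      Ideal.Quotient.eq_zero_iff_mem]
    exact hn
  refine le_antisymm (fun c hc => ?_) Ideal.le_comap_map
  rw [Ideal.mem_comap] at hc
  have := hker hc
  rw [RingHom.mem_ker, AlgHom.toRingHom_eq_coe, AlgHom.coe_toRingHom, hh, Ideal.Quotient.eq_zero_iff_mem] at this
  exact this

/-- ★ **`𝔫 (C ⊗_A B)` is prime** for a prime `𝔫 ⊇ 𝔪C` (`B = A + 𝔪B`, `𝔪B ∩ A ⊆ 𝔪`; no flatness). [folklore] -/
theorem isPrime_map (𝔪 : Ideal A)
    (hres : ∀ b : B, ∃ a : A, b - algebraMap A B a ∈ 𝔪.map (algebraMap A B))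
    (hinj : (𝔪.map (algebraMap A B)).comap (algebraMap A B) ≤ 𝔪)
    (𝔫 : Ideal C) [h𝔫p : 𝔫.IsPrime] (h𝔫 : 𝔪.map (algebraMap A C) ≤ 𝔫) :
    (𝔫.map (algebraMap C (C ⊗[A] B))).IsPrime := by
  have hcm := comap_map_eq (B := B) 𝔪 hres hinj 𝔫 h𝔫
  refine Ideal.isPrime_iff.mpr ⟨?_, fun {x y} hxy => ?_⟩
  · intro htop
    apply h𝔫p.ne_top
    rw [← hcm, htop, Ideal.comap_top]
  · obtain ⟨c₁, h₁⟩ := CompletedBaseChangeFibre.exists_sub_algebraMap_mem 𝔪 hres 𝔫 h𝔫 x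
    obtain ⟨c₂, h₂⟩ := CompletedBaseChangeFibre.exists_sub_algebraMap_mem 𝔪 hres 𝔫 h𝔫 y
    have hprod : algebraMap C (C ⊗[A] B) (c₁ * c₂) ∈ 𝔫.map (algebraMap C (C ⊗[A] B)) := by
      have : algebraMap C (C ⊗[A] B) (c₁ * c₂) =
          x * y - ((x - algebraMap C (C ⊗[A] B) c₁) * y +
            algebraMap C (C ⊗[A] B) c₁ * (y - algebraMap C (C ⊗[A] B) c₂)) := by
        rw [map_mul]; ring
      rw [this]
      exact Ideal.sub_mem _ hxy (Ideal.add_mem _ (Ideal.mul_mem_right _ _ h₁) (Ideal.mul_mem_left _ _ h₂))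
    have hc : c₁ * c₂ ∈ 𝔫 := by
      rw [← hcm, Ideal.mem_comap]
      exact hprod
    rcases h𝔫p.mem_or_mem hc with h | h
    · left
      have := Ideal.add_mem _ h₁ (Ideal.mem_map_of_mem (algebraMap C (C ⊗[A] B)) h)
      rwa [sub_add_cancel] at this
    · right
      have := Ideal.add_mem _ h₂ (Ideal.mem_map_of_mem (algebraMap C (C ⊗[A] B)) h)
      rwa [sub_add_cancel] at this

/-- ★ **Exactly one prime of `C ⊗_A B` lies over a prime `𝔫 ⊇ 𝔪C`.** [cite: StacksProject, Tag 0C4G] [folklore] -/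
theorem existsUnique_isPrime_comap_eq (𝔪 : Ideal A)
    (hres : ∀ b : B, ∃ a : A, b - algebraMap A B a ∈ 𝔪.map (algebraMap A B))
    (hinj : (𝔪.map (algebraMap A B)).comap (algebraMap A B) ≤ 𝔪)
    (𝔫 : Ideal C) [𝔫.IsPrime] (h𝔫 : 𝔪.map (algebraMap A C) ≤ 𝔫) :
    ∃! 𝔑 : Ideal (C ⊗[A] B), 𝔑.IsPrime ∧ 𝔑.comap (algebraMap C (C ⊗[A] B)) = 𝔫 := by
  refine ⟨𝔫.map (algebraMap C (C ⊗[A] B)),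
    ⟨isPrime_map 𝔪 hres hinj 𝔫 h𝔫, comap_map_eq 𝔪 hres hinj 𝔫 h𝔫⟩, ?_⟩
  rintro 𝔑 ⟨-, h𝔑⟩
  exact CompletedBaseChangeFibre.eq_map_of_comap_eq 𝔪 hres 𝔫 h𝔫 h𝔑

/-! ## §3 Completions and regularity, `B` flat -/

/-- ★★ **`(C_𝔫)^ ≅ ((C ⊗_A B)_𝔑)^`** for `B` FLAT over `A` with `B = A + 𝔪B`, `𝔪B ∩ A ⊆ 𝔪`, `𝔫 ⊇ 𝔪C` prime and `𝔑` a
prime of `C ⊗_A B` over `𝔫`. [cite: Matsumura1987, Thm. 8.4; Thm. 8.14; Thm. 22.4 (i)] [cite: StacksProject, Tag 0C4G] -/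
theorem exists_ringEquiv_adicCompletion [Module.Flat A B] (𝔪 : Ideal A)
    (hres : ∀ b : B, ∃ a : A, b - algebraMap A B a ∈ 𝔪.map (algebraMap A B))
    (𝔫 : Ideal C) [𝔫.IsPrime] (h𝔫 : 𝔪.map (algebraMap A C) ≤ 𝔫)
    (𝔑 : Ideal (C ⊗[A] B)) [𝔑.IsPrime] (h𝔑 : 𝔑.comap (algebraMap C (C ⊗[A] B)) = 𝔫) :
    ∃ e : AdicCompletion (maximalIdeal (Localization.AtPrime 𝔫)) (Localization.AtPrime 𝔫) ≃+*
        AdicCompletion (maximalIdeal (Localization.AtPrime 𝔑)) (Localization.AtPrime 𝔑),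
      ∀ c : Localization.AtPrime 𝔫,
        e (algebraMap (Localization.AtPrime 𝔫) _ c) =
          algebraMap (Localization.AtPrime 𝔑) _
            (Localization.localRingHom 𝔫 𝔑 (algebraMap C (C ⊗[A] B)) h𝔑.symm c) := by
  have hunr := CompletedBaseChangeFibre.map_eq_maximalIdeal_localization 𝔪 hres 𝔫 h𝔫 𝔑 h𝔑
  have hle : 𝔫.map (algebraMap C (C ⊗[A] B)) ≤ 𝔑 := Ideal.map_le_iff_le_comap.mpr h𝔑.ge
  have hresloc := CompletedBaseChangeFibre.forall_exists_sub_localRingHom_mem_of_prime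
    (algebraMap C (C ⊗[A] B)) 𝔫 𝔑 h𝔑.symm
    (fun s => by
      obtain ⟨r, hr⟩ := CompletedBaseChangeFibre.exists_sub_algebraMap_mem 𝔪 hres 𝔫 h𝔫 s
      exact ⟨r, hle hr⟩)
  set ℓ := Localization.localRingHom 𝔫 𝔑 (algebraMap C (C ⊗[A] B)) h𝔑.symm with hℓ
  have hflat : ℓ.Flat :=
    RingHom.Flat.localRingHom (f := algebraMap C (C ⊗[A] B)) (RingHom.flat_algebraMap_iff.mpr inferInstance)
      𝔑 𝔫 h𝔑.symm
  letI : Algebra (Localization.AtPrime 𝔫) (Localization.AtPrime 𝔑) := ℓ.toAlgebra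
  haveI : Module.Flat (Localization.AtPrime 𝔫) (Localization.AtPrime 𝔑) := hflat
  haveI : IsLocalHom (algebraMap (Localization.AtPrime 𝔫) (Localization.AtPrime 𝔑)) :=
    Localization.isLocalHom_localRingHom 𝔫 𝔑 (algebraMap C (C ⊗[A] B)) h𝔑.symm
  obtain ⟨e, -, he⟩ := CompletionOfFlatUnramified.exists_ringEquiv_adicCompletion_of_flat
    (A := Localization.AtPrime 𝔫) (B := Localization.AtPrime 𝔑)
    (CompletionOfFlatUnramifiedAtPrime.map_maximalIdeal_localRingHom_eq 𝔫 𝔑 h𝔑 hunr) hresloc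
  exact ⟨e, fun c => he c⟩

/-- ★★ **Regularity agrees** (Noetherian case, `B` flat): `C_𝔫` is regular iff `(C ⊗_A B)_𝔑` is.
[cite: Matsumura1987, Thm. 8.14; §19 p. 158] -/
theorem isRegularLocalRing_iff [Module.Flat A B] [IsNoetherianRing C] [IsNoetherianRing (C ⊗[A] B)]
    (𝔪 : Ideal A) (hres : ∀ b : B, ∃ a : A, b - algebraMap A B a ∈ 𝔪.map (algebraMap A B))
    (𝔫 : Ideal C) [𝔫.IsPrime] (h𝔫 : 𝔪.map (algebraMap A C) ≤ 𝔫)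
    (𝔑 : Ideal (C ⊗[A] B)) [𝔑.IsPrime] (h𝔑 : 𝔑.comap (algebraMap C (C ⊗[A] B)) = 𝔫) :
    IsRegularLocalRing (Localization.AtPrime 𝔫) ↔ IsRegularLocalRing (Localization.AtPrime 𝔑) := by
  haveI : IsNoetherianRing (Localization.AtPrime 𝔫) :=
    IsLocalization.isNoetherianRing 𝔫.primeCompl (Localization.AtPrime 𝔫) inferInstance
  haveI : IsNoetherianRing (Localization.AtPrime 𝔑) :=
    IsLocalization.isNoetherianRing 𝔑.primeCompl (Localization.AtPrime 𝔑) inferInstance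
  obtain ⟨e, -⟩ := exists_ringEquiv_adicCompletion 𝔪 hres 𝔫 h𝔫 𝔑 h𝔑
  constructor
  · intro h
    haveI := isRegularLocalRing_adicCompletion (Localization.AtPrime 𝔫)
    exact isRegularLocalRing_of_adicCompletion_equiv rfl e.symm
  · intro h
    haveI := isRegularLocalRing_adicCompletion (Localization.AtPrime 𝔑)
    exact isRegularLocalRing_of_adicCompletion_equiv rfl e

/-- ★ **`Spec (C ⊗_A B) → Spec C` is a bijection over `V(𝔪C)`** (`B = A + 𝔪B`, `𝔪B ∩ A ⊆ 𝔪`; no flatness).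
[cite: StacksProject, Tag 0C4G] [folklore] -/
theorem comap_bijOn (𝔪 : Ideal A)
    (hres : ∀ b : B, ∃ a : A, b - algebraMap A B a ∈ 𝔪.map (algebraMap A B))
    (hinj : (𝔪.map (algebraMap A B)).comap (algebraMap A B) ≤ 𝔪) :
    Set.BijOn (PrimeSpectrum.comap (algebraMap C (C ⊗[A] B)))
      {𝔑 : PrimeSpectrum (C ⊗[A] B) | 𝔪.map (algebraMap A C) ≤ 𝔑.asIdeal.comap (algebraMap C (C ⊗[A] B))}
      {𝔫 : PrimeSpectrum C | 𝔪.map (algebraMap A C) ≤ 𝔫.asIdeal} := by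
  refine ⟨fun 𝔑 h𝔑 => ?_, fun 𝔑₁ h₁ 𝔑₂ h₂ h12 => ?_, fun 𝔫 h𝔫 => ?_⟩
  · simpa only [Set.mem_setOf_eq, PrimeSpectrum.comap_asIdeal] using h𝔑
  · have e₁ := CompletedBaseChangeFibre.eq_map_of_comap_eq (B := B) 𝔪 hres
      (𝔑₁.asIdeal.comap (algebraMap C (C ⊗[A] B))) h₁ rfl
    have e₂ := CompletedBaseChangeFibre.eq_map_of_comap_eq (B := B) 𝔪 hres
      (𝔑₂.asIdeal.comap (algebraMap C (C ⊗[A] B))) h₂ rfl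
    have h12' : 𝔑₁.asIdeal.comap (algebraMap C (C ⊗[A] B)) = 𝔑₂.asIdeal.comap (algebraMap C (C ⊗[A] B)) := by
      simpa only [PrimeSpectrum.ext_iff, PrimeSpectrum.comap_asIdeal] using h12
    ext1
    rw [e₁, e₂, h12']
  · haveI := 𝔫.isPrime
    haveI := isPrime_map (B := B) 𝔪 hres hinj 𝔫.asIdeal h𝔫
    refine ⟨⟨𝔫.asIdeal.map (algebraMap C (C ⊗[A] B)), inferInstance⟩, ?_, ?_⟩
    · change 𝔪.map (algebraMap A C) ≤ (𝔫.asIdeal.map (algebraMap C (C ⊗[A] B))).comap (algebraMap C (C ⊗[A] B))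
      rw [comap_map_eq 𝔪 hres hinj 𝔫.asIdeal h𝔫]
      exact h𝔫
    · ext1
      rw [PrimeSpectrum.comap_asIdeal]
      exact comap_map_eq 𝔪 hres hinj 𝔫.asIdeal h𝔫

/-- ★★ **The non-regular primes over `V(𝔪)` correspond** (Noetherian case, `B` flat with `A/𝔪 ≅ B/𝔪B`).
[cite: Matsumura1987, Thm. 8.14; §19 p. 158] [cite: StacksProject, Tag 0C4G] -/
theorem comap_bijOn_not_isRegularLocalRing [Module.Flat A B] [IsNoetherianRing C] [IsNoetherianRing (C ⊗[A] B)]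
    (𝔪 : Ideal A) (hres : ∀ b : B, ∃ a : A, b - algebraMap A B a ∈ 𝔪.map (algebraMap A B))
    (hinj : (𝔪.map (algebraMap A B)).comap (algebraMap A B) ≤ 𝔪) :
    Set.BijOn (PrimeSpectrum.comap (algebraMap C (C ⊗[A] B)))
      {𝔑 : PrimeSpectrum (C ⊗[A] B) | 𝔪.map (algebraMap A C) ≤ 𝔑.asIdeal.comap (algebraMap C (C ⊗[A] B)) ∧
        ¬ IsRegularLocalRing (Localization.AtPrime 𝔑.asIdeal)}
      {𝔫 : PrimeSpectrum C | 𝔪.map (algebraMap A C) ≤ 𝔫.asIdeal ∧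
        ¬ IsRegularLocalRing (Localization.AtPrime 𝔫.asIdeal)} := by
  have hbij := comap_bijOn (B := B) (C := C) 𝔪 hres hinj
  refine ⟨fun 𝔑 h𝔑 => ?_, fun 𝔑₁ h₁ 𝔑₂ h₂ h12 => hbij.injOn h₁.1 h₂.1 h12, fun 𝔫 h𝔫 => ?_⟩
  · refine ⟨hbij.mapsTo h𝔑.1, fun hreg => h𝔑.2 ?_⟩
    rw [Set.mem_setOf_eq] at h𝔑
    have hiff := isRegularLocalRing_iff 𝔪 hres (𝔑.asIdeal.comap (algebraMap C (C ⊗[A] B))) h𝔑.1 𝔑.asIdeal rfl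
    exact hiff.mp hreg
  · obtain ⟨𝔑, h𝔑, h𝔑𝔫⟩ := hbij.surjOn h𝔫.1
    refine ⟨𝔑, ⟨h𝔑, fun hreg => h𝔫.2 ?_⟩, h𝔑𝔫⟩
    have h𝔑𝔫' : 𝔑.asIdeal.comap (algebraMap C (C ⊗[A] B)) = 𝔫.asIdeal := by
      rw [← PrimeSpectrum.comap_asIdeal, h𝔑𝔫]
    haveI := 𝔫.isPrime
    have hiff := isRegularLocalRing_iff 𝔪 hres 𝔫.asIdeal h𝔫.1 𝔑.asIdeal h𝔑𝔫'
    exact hiff.mpr hreg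

/-- ★★ **Finiteness of the non-regular primes over `V(𝔪)` transfers from `C` to `C ⊗_A B`** (`B` flat, `A/𝔪 ≅ B/𝔪B`).
[cite: Matsumura1987, Thm. 8.14] [folklore] -/
theorem finite_not_isRegularLocalRing_of_finite [Module.Flat A B] [IsNoetherianRing C]
    [IsNoetherianRing (C ⊗[A] B)] (𝔪 : Ideal A)
    (hres : ∀ b : B, ∃ a : A, b - algebraMap A B a ∈ 𝔪.map (algebraMap A B))
    (hinj : (𝔪.map (algebraMap A B)).comap (algebraMap A B) ≤ 𝔪)
    (hfin : {𝔫 : PrimeSpectrum C | 𝔪.map (algebraMap A C) ≤ 𝔫.asIdeal ∧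
      ¬ IsRegularLocalRing (Localization.AtPrime 𝔫.asIdeal)}.Finite) :
    {𝔑 : PrimeSpectrum (C ⊗[A] B) | 𝔪.map (algebraMap A C) ≤ 𝔑.asIdeal.comap (algebraMap C (C ⊗[A] B)) ∧
      ¬ IsRegularLocalRing (Localization.AtPrime 𝔑.asIdeal)}.Finite := by
  have hbij := comap_bijOn_not_isRegularLocalRing (B := B) (C := C) 𝔪 hres hinj
  refine Set.Finite.of_finite_image ?_ hbij.injOn
  rw [hbij.image_eq]
  exact hfin

/-! ## §4 The model form: `T` with a maximal ideal `𝔳`, `B = (T_𝔳)^` -/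

section Model

variable (T : Type) [CommRing T] [IsNoetherianRing T] (𝔳 : Ideal T) [h𝔳 : 𝔳.IsMaximal]

/-- `𝔳 · (T_𝔳)^ = 𝔪_{(T_𝔳)^}`. [cite: Matsumura1987, Thm. 8.11] -/
theorem map_eq_maximalIdeal_adicCompletion :
    𝔳.map (algebraMap T (AdicCompletion (maximalIdeal (Localization.AtPrime 𝔳)) (Localization.AtPrime 𝔳))) =
      maximalIdeal (AdicCompletion (maximalIdeal (Localization.AtPrime 𝔳)) (Localization.AtPrime 𝔳)) := by
  haveI : IsNoetherianRing (Localization.AtPrime 𝔳) :=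
    IsLocalization.isNoetherianRing 𝔳.primeCompl (Localization.AtPrime 𝔳) inferInstance
  have hfac : algebraMap T (AdicCompletion (maximalIdeal (Localization.AtPrime 𝔳)) (Localization.AtPrime 𝔳)) =
      (algebraMap (Localization.AtPrime 𝔳) _).comp (algebraMap T (Localization.AtPrime 𝔳)) :=
    RingHom.ext fun _ => rfl
  rw [hfac, ← Ideal.map_map, Localization.AtPrime.map_eq_maximalIdeal, ← AdicCompletion.maximalIdeal_eq_map]

/-- `(T_𝔳)^` is flat over `T` (localization, then completion of a Noetherian local ring). [cite: Matsumura1987, Thm. 8.8] -/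
theorem flat_adicCompletion_atPrime :
    Module.Flat T (AdicCompletion (maximalIdeal (Localization.AtPrime 𝔳)) (Localization.AtPrime 𝔳)) := by
  haveI : IsNoetherianRing (Localization.AtPrime 𝔳) :=
    IsLocalization.isNoetherianRing 𝔳.primeCompl (Localization.AtPrime 𝔳) inferInstance
  haveI : Module.Flat T (Localization.AtPrime 𝔳) := IsLocalization.flat (Localization.AtPrime 𝔳) 𝔳.primeCompl
  haveI : IsScalarTower T (Localization.AtPrime 𝔳)
      (AdicCompletion (maximalIdeal (Localization.AtPrime 𝔳)) (Localization.AtPrime 𝔳)) :=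
    IsScalarTower.of_algebraMap_eq (fun _ => rfl)
  exact Module.Flat.trans T (Localization.AtPrime 𝔳) _

/-- `(T_𝔳)^ = T + 𝔳 (T_𝔳)^` for `𝔳` MAXIMAL: residues of `(T_𝔳)^` come from `T_𝔳`, whose residue field is `T/𝔳`.
[cite: Matsumura1987, Thm. 8.11; Thm. 8.14] -/
theorem forall_exists_sub_mem_adicCompletion_atPrime :
    ∀ b : AdicCompletion (maximalIdeal (Localization.AtPrime 𝔳)) (Localization.AtPrime 𝔳), ∃ t : T,
      b - algebraMap T _ t ∈
        𝔳.map (algebraMap T (AdicCompletion (maximalIdeal (Localization.AtPrime 𝔳)) (Localization.AtPrime 𝔳))) := by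
  haveI : IsNoetherianRing (Localization.AtPrime 𝔳) :=
    IsLocalization.isNoetherianRing 𝔳.primeCompl (Localization.AtPrime 𝔳) inferInstance
  intro b
  rw [map_eq_maximalIdeal_adicCompletion T 𝔳]
  -- `b ≡ ℓ` for some `ℓ ∈ T_𝔳`
  obtain ⟨ℓ, hℓ⟩ := CompletedBaseChangeFibre.forall_exists_sub_mem_adicCompletion (Localization.AtPrime 𝔳) b
  rw [← AdicCompletion.maximalIdeal_eq_map] at hℓ
  -- `ℓ ≡ t` for some `t ∈ T` (`𝔳` maximal: `T/𝔳 = κ(T_𝔳)`)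
  obtain ⟨t, ht⟩ := Ideal.Quotient.mk_surjective
    ((IsLocalization.AtPrime.equivQuotMaximalIdeal 𝔳 (Localization.AtPrime 𝔳)).symm (Ideal.Quotient.mk _ ℓ))
  have hmk : Ideal.Quotient.mk (maximalIdeal (Localization.AtPrime 𝔳)) (algebraMap T (Localization.AtPrime 𝔳) t) =
      Ideal.Quotient.mk _ ℓ := by
    rw [← IsLocalization.AtPrime.equivQuotMaximalIdeal_apply_mk 𝔳 (Localization.AtPrime 𝔳), ht,
      RingEquiv.apply_symm_apply]
  have h1 : ℓ - algebraMap T (Localization.AtPrime 𝔳) t ∈ maximalIdeal (Localization.AtPrime 𝔳) := by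
    rw [← Ideal.Quotient.eq, hmk]
  refine ⟨t, ?_⟩
  have h2 := map_nonunit (algebraMap (Localization.AtPrime 𝔳)
    (AdicCompletion (maximalIdeal (Localization.AtPrime 𝔳)) (Localization.AtPrime 𝔳))) _ h1
  rw [map_sub] at h2
  have := Ideal.add_mem _ hℓ h2
  rwa [sub_add_sub_cancel] at this

/-- `𝔳 (T_𝔳)^ ∩ T = 𝔳` (`𝔳` maximal and `𝔳 (T_𝔳)^ ≠ ⊤`). [folklore] -/
theorem comap_map_le_adicCompletion_atPrime :
    (𝔳.map (algebraMap T (AdicCompletion (maximalIdeal (Localization.AtPrime 𝔳)) (Localization.AtPrime 𝔳)))).comap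
      (algebraMap T _) ≤ 𝔳 := by
  haveI : IsNoetherianRing (Localization.AtPrime 𝔳) :=
    IsLocalization.isNoetherianRing 𝔳.primeCompl (Localization.AtPrime 𝔳) inferInstance
  have hne : (𝔳.map (algebraMap T (AdicCompletion (maximalIdeal (Localization.AtPrime 𝔳))
      (Localization.AtPrime 𝔳)))).comap (algebraMap T _) ≠ ⊤ := by
    rw [map_eq_maximalIdeal_adicCompletion T 𝔳]
    exact Ideal.comap_ne_top _ (maximalIdeal.isMaximal _).ne_top
  exact (h𝔳.eq_of_le hne Ideal.le_comap_map).ge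

variable (C : Type) [CommRing C] [Algebra T C]

/-- ★★ **MODEL FORM, points**: for a `T`-algebra `C` and a prime `𝔫 ⊇ 𝔳C` there is exactly one prime of `C ⊗_T (T_𝔳)^`
over `𝔫`. (Chartwise: the points of `Bl_{J (T_𝔳)^}(Spec (T_𝔳)^)` over the closed point correspond one-to-one to the points
of `Bl_J(Spec T)` over `𝔳`.) [cite: StacksProject, Tag 0C4G] [cite: Matsumura1987, Thm. 8.14] -/
theorem existsUnique_isPrime_comap_eq_model (𝔫 : Ideal C) [𝔫.IsPrime] (h𝔫 : 𝔳.map (algebraMap T C) ≤ 𝔫) :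
    ∃! 𝔑 : Ideal (C ⊗[T] AdicCompletion (maximalIdeal (Localization.AtPrime 𝔳)) (Localization.AtPrime 𝔳)),
      𝔑.IsPrime ∧ 𝔑.comap (algebraMap C _) = 𝔫 :=
  existsUnique_isPrime_comap_eq 𝔳 (forall_exists_sub_mem_adicCompletion_atPrime T 𝔳)
    (comap_map_le_adicCompletion_atPrime T 𝔳) 𝔫 h𝔫

/-- ★★ **MODEL FORM, regularity**: for a prime `𝔑` of `C ⊗_T (T_𝔳)^` over `𝔫 ⊇ 𝔳C` (`C`, `C ⊗_T (T_𝔳)^` Noetherian),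
`C_𝔫` is regular iff `(C ⊗_T (T_𝔳)^)_𝔑` is. [cite: Matsumura1987, Thm. 8.14; §19 p. 158] -/
theorem isRegularLocalRing_iff_model [IsNoetherianRing C]
    [IsNoetherianRing (C ⊗[T] AdicCompletion (maximalIdeal (Localization.AtPrime 𝔳)) (Localization.AtPrime 𝔳))]
    (𝔫 : Ideal C) [𝔫.IsPrime] (h𝔫 : 𝔳.map (algebraMap T C) ≤ 𝔫)
    (𝔑 : Ideal (C ⊗[T] AdicCompletion (maximalIdeal (Localization.AtPrime 𝔳)) (Localization.AtPrime 𝔳)))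
    [𝔑.IsPrime] (h𝔑 : 𝔑.comap (algebraMap C _) = 𝔫) :
    IsRegularLocalRing (Localization.AtPrime 𝔫) ↔ IsRegularLocalRing (Localization.AtPrime 𝔑) := by
  haveI := flat_adicCompletion_atPrime T 𝔳
  exact isRegularLocalRing_iff 𝔳 (forall_exists_sub_mem_adicCompletion_atPrime T 𝔳) 𝔫 h𝔫 𝔑 h𝔑

/-- ★★ **MODEL FORM, finiteness of the singular points over `V(𝔳)`**: if `C` has finitely many non-regular primes over
`V(𝔳)`, so has `C ⊗_T (T_𝔳)^` (and they correspond under `Spec (C ⊗_T (T_𝔳)^) → Spec C`,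
`comap_bijOn_not_isRegularLocalRing`). [cite: Matsumura1987, Thm. 8.14] [folklore] -/
theorem finite_not_isRegularLocalRing_model [IsNoetherianRing C]
    [IsNoetherianRing (C ⊗[T] AdicCompletion (maximalIdeal (Localization.AtPrime 𝔳)) (Localization.AtPrime 𝔳))]
    (hfin : {𝔫 : PrimeSpectrum C | 𝔳.map (algebraMap T C) ≤ 𝔫.asIdeal ∧
      ¬ IsRegularLocalRing (Localization.AtPrime 𝔫.asIdeal)}.Finite) :
    {𝔑 : PrimeSpectrum (C ⊗[T] AdicCompletion (maximalIdeal (Localization.AtPrime 𝔳)) (Localization.AtPrime 𝔳)) |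
      𝔳.map (algebraMap T C) ≤ 𝔑.asIdeal.comap (algebraMap C _) ∧
      ¬ IsRegularLocalRing (Localization.AtPrime 𝔑.asIdeal)}.Finite := by
  haveI := flat_adicCompletion_atPrime T 𝔳
  exact finite_not_isRegularLocalRing_of_finite 𝔳 (forall_exists_sub_mem_adicCompletion_atPrime T 𝔳)
    (comap_map_le_adicCompletion_atPrime T 𝔳) hfin

end Model

end Summit.ResolutionOfSingularities.ResolutionOfSingularities.Theorems.FRationalResolution.CompletedBaseChangeFibreFlat

end
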